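import Summits.ABC.StewartYu.PadicG3ParN
import HarnessLib

/-!
# The `𝔑`-threaded `p`-adic Gen-3 record `PadicG3ParN` — END facts: box, range, (K1), (K2), exit A

Support file (elementary theorems; no named facts). Cell `abc-stewartyu`, route `YuMatveevShapeRat`, crux
`PadicCoreOddRat`; seat p1 (record owner). Continues `PadicG3ParN` (structure and closed forms there).

With the END scaling `K·N ↔ 2^{ŜN}` (`2^{n+23}·K·N·2^{lgg} < 2^{ŜN} ≤ 2^{n+24}·K·N·2^{lgg}`):
* the END box `DN j = ⌊K·N·LV/(2^{ŜN} Aⱼ)⌋ + 1 ≤ LV/(2^{n+22}·2^{lgg}) + 1` — the SAME `Dmax` as the v2 family,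
  so (K1) IS the v2 fact `K1V'` (not restated);
* the END range `XsV ŜN > 2^{n+22}·K·N·g·XV`, `XfinN = 2ⁿ·XsV ŜN/(n+1) ≥ XfinV` (under `N_q = K`), and
  `D₀N ≤ D₀V` (the `Y₀`-degree is divided by `N`), so **(K2N)** follows from (K2V);
* **exit A** (`exitAN`) by lp-1's `RecordExitsNumeric.exitA_of_bounds` at
  `(D₀, S₀, X, Dmax) := (D₀N, S₀NV, XfinN, LV/(2^{n+22}2^{lgg}) + 1)`.

## References
* [Nesterenko2003] Yu. V. Nesterenko, LNM 1819 (2003) — §5.2 (5.5), (5.12)–(5.17), Lemma 5.3.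
* [Yu2013] K. Yu, Acta Math. 211 (2013) — (6.12).
-/

noncomputable section

open Finset Real

namespace Summit.ABC.StewartYu

namespace PadicG3ParN

open PadicG3Par (Cb cM cG)

variable {n : ℕ} (P : PadicG3ParN n)

/-! ### The END box and range -/

/-- `K·N·LV/(2^{ŜN} A j) < LV/(2^{n+22} 2^{lgg})` (real; `A j > 1/2`). [cite: Nesterenko2003, §5.2 (5.17)] -/
theorem KN_LV_div_lt (j : Fin n) :
    (P.K : ℝ) * P.N * P.LV / (2 ^ P.SdN * P.A j) < (P.LV : ℝ) / (2 ^ (n + 22) * 2 ^ P.lgg) := by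
  have hA := P.A_pos j
  have hA2 : (1 / 2 : ℝ) < P.A j := by have := Real.log_two_gt_d9; have := P.hA j; linarith
  have hS : (2 : ℝ) ^ (n + 23) * (P.K * P.N) * 2 ^ P.lgg < 2 ^ P.SdN := by exact_mod_cast P.lt_two_pow_SdN
  have hL : (0 : ℝ) < P.LV := by linarith [P.one_le_LV]
  have hKN : (0 : ℝ) < P.K * P.N := mul_pos P.K_pos P.N_pos
  rw [div_lt_div_iff₀ (by positivity) (by positivity)]
  have e : (2 : ℝ) ^ (n + 23) = 2 ^ (n + 22) * 2 := by ring
  rw [e] at hS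
  have h4 : (2 : ℝ) ^ P.SdN * (1 / 2) < 2 ^ P.SdN * P.A j := mul_lt_mul_of_pos_left hA2 (by positivity)
  have h3 : (2 : ℝ) ^ (n + 22) * (P.K * P.N) * 2 ^ P.lgg < 2 ^ P.SdN * P.A j := by linarith
  have h5 := mul_lt_mul_of_pos_left h3 hL
  have e2 : (P.K : ℝ) * P.N * P.LV * (2 ^ (n + 22) * 2 ^ P.lgg) =
      P.LV * (2 ^ (n + 22) * (P.K * P.N) * 2 ^ P.lgg) := by ring
  rw [e2]; linarith

/-- **`DN j ≤ LV/(2^{n+22} 2^{lgg}) + 1`** (the same `Dmax` as the v2 family). [cite: Nesterenko2003, §5.2 (5.17)] -/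
theorem DN_le_DmaxV (j : Fin n) : P.DN j ≤ P.LV / (2 ^ (n + 22) * 2 ^ P.lgg) + 1 := by
  unfold DN
  refine Nat.add_le_add_right ?_ 1
  have h := (P.KN_LV_div_lt j).le
  calc ⌊(P.K : ℝ) * P.N * P.LV / (2 ^ P.SdN * P.A j)⌋₊ ≤ ⌊(P.LV : ℝ) / (2 ^ (n + 22) * 2 ^ P.lgg)⌋₊ :=
        Nat.floor_le_floor h
    _ = P.LV / (2 ^ (n + 22) * 2 ^ P.lgg) := by
        rw [show ((2 : ℝ) ^ (n + 22) * 2 ^ P.lgg) = ((2 ^ (n + 22) * 2 ^ P.lgg : ℕ) : ℝ) by push_cast; ring]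
        exact Nat.floor_div_eq_div _ _

/-- `1 ≤ DN j`. [folklore] -/
theorem one_le_DN (j : Fin n) : 1 ≤ P.DN j := by unfold DN; omega

/-- `K·N·LV/(2^{ŜN} A j) < DN j` (the END box covers the scaled exponents). [cite: Nesterenko2003, (5.5)] -/
theorem lt_DN (j : Fin n) : (P.K : ℝ) * P.N * P.LV / (2 ^ P.SdN * P.A j) < P.DN j := by
  unfold DN; push_cast; exact Nat.lt_floor_add_one _

/-- **`2^{n+22} · K · N · g · XV < XsV ŜN`** (the range bought by the depth). [cite: Yu2013, (6.12)] -/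
theorem XsV_SdN_gt : (2 : ℝ) ^ (n + 22) * (P.K * P.N) * P.g * P.XV < P.XsV P.SdN := by
  have h1 := P.XsV_gt P.SdN
  have hS : (2 : ℝ) ^ (n + 23) * (P.K * P.N) * 2 ^ P.lgg < 2 ^ P.SdN := by exact_mod_cast P.lt_two_pow_SdN
  have hl : (1 : ℝ) ≤ 2 ^ P.lgg := one_le_pow₀ (by norm_num)
  have hg := lt_of_lt_of_le one_pos P.one_le_g
  have hX : (0 : ℝ) < P.XV := by linarith [P.XV_ge_128]
  have hKN : (0 : ℝ) < P.K * P.N := mul_pos P.K_pos P.N_pos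
  have h0 : (0 : ℝ) ≤ 2 ^ (n + 23) * (P.K * P.N) := by positivity
  have h2 : (2 : ℝ) ^ (n + 23) * (P.K * P.N) ≤ 2 ^ P.SdN := by
    have := le_mul_of_one_le_right h0 hl
    linarith
  have hgX : 0 ≤ P.g * P.XV := by positivity
  have h3 : (2 : ℝ) ^ (n + 22) * (P.K * P.N) * P.g * P.XV ≤ 2 ^ P.SdN * P.g * P.XV / 2 := by
    have := mul_le_mul_of_nonneg_right h2 hgX
    have e : (2 : ℝ) ^ (n + 23) = 2 * 2 ^ (n + 22) := by ring
    rw [e] at this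
    linarith
  linarith

/-- `2^{n+22} · K · N · XV ≤ XsV ŜN` (natural numbers, `g ≥ 1`). [cite: Nesterenko2003, §5.2 (5.12)] -/
theorem two_pow_mul_le_XsV_SdN : 2 ^ (n + 22) * (P.K * P.N) * P.XV ≤ P.XsV P.SdN := by
  have h := P.XsV_SdN_gt
  have hg := P.one_le_g
  have h0 : (0 : ℝ) ≤ 2 ^ (n + 22) * (P.K * P.N) * P.XV := by positivity
  have h1 : (2 : ℝ) ^ (n + 22) * (P.K * P.N) * P.XV ≤ P.XsV P.SdN := by nlinarith
  exact_mod_cast h1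

/-- `XsV ŜN ≤ XfinN` (`2ⁿ ≥ n+1`). [folklore] -/
theorem XsV_le_XfinN : P.XsV P.SdN ≤ P.XfinN := by
  unfold XfinN
  rw [Nat.le_div_iff_mul_le (by positivity), mul_comm]
  exact Nat.mul_le_mul_right _ (Nat.succ_le_of_lt Nat.lt_two_pow_self)

/-- `1 ≤ XfinN`. [folklore] -/
theorem one_le_XfinN : 1 ≤ P.XfinN := le_trans (P.one_le_XsV _) P.XsV_le_XfinN

/-- `XfinV ≤ XfinN` under `N_q = K` (the range only grows with the depth). [folklore] -/
theorem XfinV_le_XfinN (hNq : P.Nq = P.K) : P.XfinV ≤ P.XfinN := by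
  unfold XfinN PadicG3Par.XfinV
  refine Nat.div_le_div_right (Nat.mul_le_mul_left _ ?_)
  unfold PadicG3Par.XsV
  refine Nat.add_le_add_right (Nat.floor_le_floor ?_) 1
  have hS := P.SdG_le_SdN hNq
  have hG : 0 < P.G := by linarith [P.eight_le_G]
  have hX : (0 : ℝ) ≤ P.XV := by positivity
  have h2 : (2 : ℝ) ^ P.SdG ≤ 2 ^ P.SdN := pow_le_pow_right₀ (by norm_num) hS
  have : (0 : ℝ) ≤ P.G * P.XV / (16 * (n + 1)) := by positivity
  calc (2 : ℝ) ^ P.SdG * P.G * P.XV / (16 * (n + 1)) = 2 ^ P.SdG * (P.G * P.XV / (16 * (n + 1))) := by ring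
    _ ≤ 2 ^ P.SdN * (P.G * P.XV / (16 * (n + 1))) := mul_le_mul_of_nonneg_right h2 this
    _ = 2 ^ P.SdN * P.G * P.XV / (16 * (n + 1)) := by ring

/-! ### The END facts (K2), exit A ((K1) = `PadicG3Par.K1V'` verbatim) -/

/-- **(K2N)** `(n+1)² D₀N < (S₀NV + 1)(2 XfinN + 1)` under `N_q = K` (from (K2V): `D₀N ≤ D₀V`, `XfinV ≤ XfinN`).
[cite: Nesterenko2003, §5.2 Lemma 5.3 (5.15)–(5.16)] -/
theorem K2N (hNq : P.Nq = P.K) : (n + 1) ^ 2 * P.D0N < (P.S0NV + 1) * (2 * P.XfinN + 1) := by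
  have h := P.K2V
  have h1 : (n + 1) ^ 2 * P.D0N ≤ (n + 1) ^ 2 * P.D0V := Nat.mul_le_mul_left _ P.D0N_le_D0V
  have h2 : (P.S0NV + 1) * (2 * P.XfinV + 1) ≤ (P.S0NV + 1) * (2 * P.XfinN + 1) :=
    Nat.mul_le_mul_left _ (by have := P.XfinV_le_XfinN hNq; omega)
  omega

/-- **exit (A) of the END for the `N`-record** at `(D₀, S₀, X, Dmax) := (D₀N, S₀NV, XfinN, LV/(2^{n+22}2^{lgg}) + 1)`
(and `DN j ≤ Dmax` by `DN_le_DmaxV`). [cite: Nesterenko2003, §5.2 Lemma 5.3] -/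
theorem exitAN (hNq : P.Nq = P.K) : ∀ r d₀ : ℕ, r ≤ n → d₀ ≤ 1 →
    (n + 1).factorial * 2 ^ n * P.D0N * (P.LV / (2 ^ (n + 22) * 2 ^ P.lgg) + 1) ^ r <
      Nat.choose (P.S0NV + (r + 1 - d₀)) (r + 1 - d₀) * (2 * P.XfinN + 1) *
        ((d₀ + (n - r)).factorial * 2 ^ (n - r) * P.D0N ^ d₀) :=
  RecordExitsNumeric.exitA_of_bounds P.one_le_XfinN P.one_le_D0N P.K1V' (P.K2N hNq)

end PadicG3ParN

end Summit.ABC.StewartYu
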